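import Literature.AlgebraicGeometry.HodgeTheory.HodgeFiltrationChartBallFramesOfFamily
import Literature.AlgebraicGeometry.HodgeTheory.HodgeFramesOfChartBallFramesChart
import HarnessLib

/-!
# Griffiths' theorem for smooth projective families with quasi-projective total space, with the
# chart of the base PINNED to the algebraic chart at `t₁` (chart-explicit twin of
# `griffiths1968_holomorphicHodgeSubbundlesQP_holds`)

Topic: Hodge theory in families (Griffiths 1968 Thm. 1.1; Voisin (2002), §10.2.1 Thm. 10.3). One
theorem, no definition, no named fact. Written by the prover seat `hodge-nonav-prover-Bx` (g18, cell
`hodge-nonav`) on the ASK «PINNED CHART EXPORT» of `hodge-nonav-19716-p2` (g12, 2026-08-29): the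
statement `Griffiths1968_holomorphicHodgeSubbundlesQP` produces an OPAQUE chart `ψ` of the base, so only
topological smallness of Hodge loci transfers to coefficient spaces; for MEASURE-zero statements the
consumer needs to know that `ψ` is the holomorphic algebraic chart `extChartAt 𝓘(ℂ, ℂᵈ) t₁`.

`griffiths1968_holomorphicHodgeSubbundlesQP_chart_holds`: the body of
`Griffiths1968_holomorphicHodgeSubbundlesQP` (same binders, same conclusion) with THREE conjuncts
inserted right after `W ⊆ ψ.source`, in the algebraic-chart atlas of `S(ℂ)`:
`(∀ t, ψ t = extChartAt 𝓘(ℂ, Fin d → ℂ) t₁.1 t.1)`, `(∀ z, (ψ.symm z).1 = (extChartAt …).symm z)`,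
`(∀ t, t ∈ ψ.source ↔ t.1 ∈ (extChartAt …).source)` — the extra clauses of
`exists_hodgeFrames_of_chartBallFrames_chart` (`hodge-nonav-20241-p1`). Proof = the proof of
`griffiths1968_holomorphicHodgeSubbundlesQP_holds` with that theorem in place of
`exists_hodgeFrames_of_chartBallFrames`.

Honest scope: a literature theorem (Griffiths ∕ Voisin) in a chart-explicit form; nothing here says HC
or any rung is proved.

## References

* [Griffiths1968PeriodsII] P. Griffiths, Periods of integrals on algebraic manifolds II, Amer. J. Math.
  90 (1968), Thm. 1.1.
* [VoisinHodgeI2002] C. Voisin, Hodge Theory and Complex Algebraic Geometry I, CUP (2002), §10.2.1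
  Thm. 10.3, §10.2.2.
-/

noncomputable section

open scoped Manifold TensorProduct
open CategoryTheory AlgebraicGeometry
open _root_.Topology _root_.Filter
open Literature.AlgebraicTopology.SingularHomology
open Literature.AlgebraicGeometry.Motives Literature.NumberTheory.Transcendental

namespace Literature.AlgebraicGeometry.HodgeTheory

/-- **Griffiths' theorem (Voisin I Thm. 10.3; Griffiths 1968 Thm. 1.1), quasi-projective total space,
chart-explicit form**: the body of `Griffiths1968_holomorphicHodgeSubbundlesQP` with the chart `ψ` of
the base PINNED to the algebraic chart `extChartAt 𝓘(ℂ, ℂᵈ) t₁` (three extra conjuncts after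
`W ⊆ ψ.source`; module docstring). [cite: VoisinHodgeI2002, §10.2.1 Thm. 10.3 and §10.2.2]
[cite: Griffiths1968PeriodsII, Thm. 1.1] -/
theorem griffiths1968_holomorphicHodgeSubbundlesQP_chart_holds
    {𝒳 S : SchemeOver ℂ} (f : 𝒳 ⟶ S) (n k d : ℕ)
    (hf : IsSmoothProjectiveFamily f n) (hS : IsQuasiProjectiveOver S) (h𝒳 : IsQuasiProjectiveOver 𝒳)
    [AlgebraicGeometry.SmoothOfRelativeDimension d S.hom]
    (hU : IsCohomologicallyLocallyTrivialOn f (Set.univ : Set (ComplexPoints S)))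
    (A : ∀ t : ComplexPoints S, HodgeModel n (fiberOver f t)) (hA : ∀ t, (A t).IsHodgeSymmetric)
    [∀ t, Module.Finite ℚ (singularCohomology ℚ ℚ (ComplexPoints (fiberOver f t)) k)]
    (s t₁ : (Set.univ : Set (ComplexPoints S))) (N : Set (Set.univ : Set (ComplexPoints S)))
    (hN : N ∈ 𝓝 t₁) :
    letI : AlgebraicGeometry.Smooth S.hom := AlgebraicGeometry.SmoothOfRelativeDimension.smooth d _
    letI : AlgebraicGeometry.LocallyOfFiniteType S.hom := inferInstance
    letI := chartedSpaceOfCharts (ComplexPoints.algebraicChart S d)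
      (ComplexPoints.mem_algebraicChart_source S d)
    ∃ W : Set (Set.univ : Set (ComplexPoints S)), IsOpen W ∧ t₁ ∈ W ∧ W ⊆ N ∧ IsPathConnected W ∧
    ∃ ψ : OpenPartialHomeomorph (Set.univ : Set (ComplexPoints S)) (Fin d → ℂ),
      W ⊆ ψ.source ∧
      (∀ t, ψ t = extChartAt 𝓘(ℂ, Fin d → ℂ) t₁.1 t.1) ∧
      (∀ z, (ψ.symm z).1 = (extChartAt 𝓘(ℂ, Fin d → ℂ) t₁.1).symm z) ∧
      (∀ t, t ∈ ψ.source ↔ t.1 ∈ (extChartAt 𝓘(ℂ, Fin d → ℂ) t₁.1).source) ∧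
    ∀ (T₁ : singularCohomology ℚ ℚ (ComplexPoints (fiberOver f s.1)) k ≃ₗ[ℚ]
        singularCohomology ℚ ℚ (ComplexPoints (fiberOver f t₁.1)) k),
      (∃ δ₁ : Path.Homotopic.Quotient s t₁,
        ∀ v, ofRatClass _ k (T₁ v) = transportFun f k hU δ₁ (ofRatClass _ k v)) →
      ∀ p : ℤ, ∃ (r : ℕ)
        (w : Fin r → Set.Elem (Set.univ : Set (ComplexPoints S)) →
          ℂ ⊗[ℚ] singularCohomology ℚ ℚ (ComplexPoints (fiberOver f s.1)) k),
        (∀ t ∈ W, ∀ (ε : Path t₁ t), (∀ r', ε r' ∈ W) →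
          ∀ (T : singularCohomology ℚ ℚ (ComplexPoints (fiberOver f s.1)) k ≃ₗ[ℚ]
            singularCohomology ℚ ℚ (ComplexPoints (fiberOver f t.1)) k),
          (∀ v, ofRatClass _ k (T v) = transportFun f k hU ⟦ε⟧ (ofRatClass _ k (T₁ v))) →
          LinearIndependent ℂ (fun i ↦ w i t) ∧
            (((A t.1).hodgeStructure (hf.isSmoothProjective t.1) (hA t.1) k).comapEquiv T).F p =
              Submodule.span ℂ (Set.range fun i ↦ w i t)) ∧
        (∀ (i : Fin r)
          (φ : Module.Dual ℂ (ℂ ⊗[ℚ] singularCohomology ℚ ℚ (ComplexPoints (fiberOver f s.1)) k)),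
          AnalyticOnNhd ℂ (fun z ↦ φ (w i (ψ.symm z))) (ψ '' W)) := by
  haveI : AlgebraicGeometry.IsSeparated S.hom := hS.isVarietyPair_ofScheme.isSeparated
  obtain ⟨r, Φ, e, r₀, R, w, -, -, hΦ0, -, hΦsm, -, he, hr₀, hr₀r, hwan, hwframe⟩ :=
    exists_chartBall_hodgeFrames f (d := d) k hf h𝒳 t₁.1
  obtain ⟨W₀, hW₀o, ht₁W₀, hW₀N, hW₀pc, ψ, hW₀ψ, hψ₁, hψ₂, hψ₃, hK7h⟩ :=
    exists_hodgeFrames_of_chartBallFrames_chart f hf hU A hA k s t₁ N hN Φ hΦ0 hΦsm e he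
      (fun p ↦ ⟨r₀, hr₀, hr₀r, R p, w p, hwan p, hwframe p⟩)
  exact ⟨W₀, hW₀o, ht₁W₀, hW₀N, hW₀pc, ψ, hW₀ψ, hψ₁, hψ₂, hψ₃, fun T₁ _ p ↦ hK7h T₁ p⟩

end Literature.AlgebraicGeometry.HodgeTheory

end
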